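import Summits.HodgeConjecture.HodgeConjecture.Theorems.EightfoldBlochSeedsChernCharacterOnBettiAnalytificationChern
import Literature.AlgebraicTopology.CharacteristicClasses.ChernClassRingChange
import Literature.AlgebraicGeometry.HodgeTheory.HodgeFiltration
import HarnessLib

/-!
# K1 (analytification bridge), step K1c: the Betti Chern classes of an algebraic vector bundle with
# COMPLEX coefficients — integral (hence rational) classes in `complexBetti`, generically trivial, `c₁` algebraic

Route `EightfoldBlochSeeds` / item `stmt-HodgeConjecture-19780` (`ChernCharacterOnBetti`), helper
(`--supports`). HONEST FRAMING: nothing here proves 19780 / 18880 / 18882 / 18883 / H2 / HC_AV / HC;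
no definition, no named fact.

WHAT. `ChernCharacterBetti.ch X E i` lives in `complexBetti X (2 * i) = H²ⁱ(X(ℂ); ℂ)`. For a complex
vector bundle `E` on `X(ℂ)` (in particular the topological analytification of an algebraic vector
bundle, steps 1–3) the `ℂ`-valued Chern classes "as the tree needs them" are
`theChernClassTheory.chernClassIn ℂ E i = (ℤ → ℂ)_* cᵢ(E) ∈ H²ⁱ(X(ℂ); ℂ)` (images of the integral
classes `chernClassZ E i`; `CharacteristicClasses.TopologicalChernClasses`). This file records:

* `chernClassIn_complex_eq_chernClassR` — over the (compact Hausdorff) complex points of a smooth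
  projective `X` they ARE Grothendieck's classes formed with `ℂ`-coefficients,
  `ComplexVectorBundle.chernClassR ℂ` (the new Literature theorem
  `CharacteristicClasses.chernClassR_ringChange`: Husemoller Ch. 17 Def. 2.6 is natural in the
  coefficient ring), so everything the tree proves about `chernClassR R` for a general ring (Whitney
  sum, (C₁), projective bundle formula) applies to them directly;
* `isIntegralClass_chernClassIn_complex`, `isRationalClass_chernClassIn_complex` — they are integral,
  hence rational, classes (`HodgeTheory.IsIntegralClass` / `IsRationalClass`: the field
  `isRationalClass_ch` of `ChernCharacterBetti` for Chern classes);
* `chernClassIn_complex_restrictToOpen_eq_zero_of_comparison`,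
  `chernClassIn_complex_mem_coniveauFiltration_one_of_comparison` — the `ℂ`-coefficient versions of
  step 3: for a topological comparison datum `(E, α)` of an `𝒪_X`-module `F` on a smooth projective
  `X`, `cᵢ(E)_ℂ` dies on `U(ℂ)` for every Zariski open `U` carrying an algebraic frame and lies in
  `N¹ H²ⁱ(X(ℂ); ℂ)` (`i ≥ 1`, `U ≠ ∅`);
* **`chernClassIn_complex_one_mem_algebraicClasses_of_comparison` — `c₁(E)_ℂ ∈ algebraicClasses X 1`**
  (`= N¹ H²(X(ℂ); ℂ)` by definition): the field `ch_mem_algebraicClasses` of `ChernCharacterBetti` in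
  degree `1` (`ch₁ = c₁`) for every such datum;
* `exists_analytification_chernClassIn_complex` — packaged with the existence of step 2.

[cite: HusemollerFibreBundles1994, Ch. 17 Def. 2.6, §3 and Ch. 20 §4] [cite: SerreGAGA1956, §3 n°9 Déf. 2 and §4 n°20]
[cite: BlochOgus1974ENS, (3.8)] [cite: HatcherAT2002, §3.1 p. 198]
-/

noncomputable section

-- single-problem summit (Problem = Summit): the mandated namespace repeats `HodgeConjecture`.
set_option linter.dupNamespace false

open CategoryTheory AlgebraicGeometry Bundle Topology
open Literature.AlgebraicGeometry.Motives Literature.AlgebraicGeometry.HodgeTheory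
open Literature.AlgebraicTopology.SingularHomology Literature.AlgebraicTopology.CharacteristicClasses

namespace Summit.HodgeConjecture.HodgeConjecture.Theorems

variable {n : ℕ} {X : SchemeOver ℂ} {F : X.left.Modules} {r : ℕ}

/-- **The `ℂ`-valued Chern classes are Grothendieck's classes over `ℂ`**: for `X` smooth projective
(so that `X(ℂ)` is compact Hausdorff) and a complex vector bundle `E` on `X(ℂ)`,
`theChernClassTheory.chernClassIn ℂ E i = E.chernClassR ℂ i` in `complexBetti X (2 * i)`.
[cite: HusemollerFibreBundles1994, Ch. 17 Def. 2.6 and Ch. 20 §4] -/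
theorem chernClassIn_complex_eq_chernClassR (hX : IsSmoothProjective n X)
    (E : ComplexVectorBundle.{0, 0} (ComplexPoints X)) (i : ℕ) :
    haveI := ComplexPoints.t2Space_of_isSmoothProjective hX
    haveI := paracompactSpace_complexPoints_of_isSmoothProjective hX
    (theChernClassTheory.chernClassIn ℂ E i : complexBetti X (2 * i)) = E.chernClassR ℂ i := by
  haveI := ComplexPoints.t2Space_of_isSmoothProjective hX
  haveI := paracompactSpace_complexPoints_of_isSmoothProjective hX
  exact theChernClassTheory_chernClassIn ℂ E i

/-- **The `ℂ`-valued Chern classes are integral classes** of `complexBetti X (2 * i)` (represented by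
`(ℤ ↪ ℂ) ∘ ζ` for an integral cocycle `ζ`). [cite: HatcherAT2002, §3.1 p. 198] -/
theorem isIntegralClass_chernClassIn_complex (E : ComplexVectorBundle.{0, 0} (ComplexPoints X)) (i : ℕ) :
    IsIntegralClass (theChernClassTheory.chernClassIn ℂ E i : complexBetti X (2 * i)) := by
  change IsIntegralClass (singularCohomology.ringChange (Int.castRingHom ℂ) (ComplexPoints X) (2 * i) (chernClassZ E i))
  induction chernClassZ E i using singularCohomology_induction_on with
  | h ζ =>
    refine ⟨cocyclesRingChange (Int.castRingHom ℂ) (2 * i) ζ,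
      (singularCohomology.ringChange_π _ ζ).symm, fun σ ↦ ⟨coFn ζ σ, ?_⟩⟩
    change ((coFn ζ σ : ℤ) : ℂ) =
      coFn (cocyclesRingChange (Int.castRingHom ℂ) (2 * i) ζ) σ
    rw [coFn_cocyclesRingChange, Function.comp_apply, eq_intCast]

/-- **The `ℂ`-valued Chern classes are rational classes** (the field `isRationalClass_ch` of
`ChernCharacterBetti` for the Chern classes themselves). [cite: VoisinHodgeI2002, Thm. 11.23] -/
theorem isRationalClass_chernClassIn_complex (E : ComplexVectorBundle.{0, 0} (ComplexPoints X)) (i : ℕ) :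
    IsRationalClass (theChernClassTheory.chernClassIn ℂ E i : complexBetti X (2 * i)) :=
  (isIntegralClass_chernClassIn_complex E i).isRationalClass

/-- **`cᵢ(E)_ℂ|_{U(ℂ)} = 0`** for a topological comparison datum `(E, α)` of an `𝒪_X`-module `F` on a
smooth projective `X`, a Zariski open `U` carrying an algebraic frame of `F`, and `i ≥ 1`
(`ℂ`-coefficient version of step 3, by the change of coefficients `ℤ → ℂ`).
[cite: HusemollerFibreBundles1994, Ch. 17 §3 (C₁) and Prop. 4.1] [cite: SerreGAGA1956, §4 n°20] -/
theorem chernClassIn_complex_restrictToOpen_eq_zero_of_comparison (hX : IsSmoothProjective n X)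
    (E : ComplexVectorBundle.{0, 0} (ComplexPoints X))
    (α : ∀ U : X.left.Opens, Γ(F, U) → ∀ P : ComplexPoints X, E.E P)
    (hcont : ∀ (U : X.left.Opens) (σ : Γ(F, U)),
      ContinuousOn (fun P ↦ (⟨P, α U σ P⟩ : TotalSpace E.F E.E)) {P | P.pt ∈ U})
    (hframe : ∀ (U : X.left.Opens) (t : Fin r → Γ(F, U)), IsSectionFrame F U t →
      ∀ P : ComplexPoints X, P.pt ∈ U → LinearIndependent ℂ (fun j ↦ α U (t j) P) ∧
        ⊤ ≤ Submodule.span ℂ (Set.range fun j ↦ α U (t j) P))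
    {U : X.left.Opens} {t : Fin r → Γ(F, U)} (ht : IsSectionFrame F U t) {i : ℕ} (hi : 0 < i) :
    restrictToCompl ℂ X (2 * i) ((U : Set X.left)ᶜ) (theChernClassTheory.chernClassIn ℂ E i) = 0 := by
  have h := chernClassZ_restrictToOpen_eq_zero_of_comparison hX E α hcont hframe ht hi
  change singularCohomology.map ℂ ℂ _ (2 * i)
    (singularCohomology.ringChange (Int.castRingHom ℂ) (ComplexPoints X) (2 * i) (chernClassZ E i)) = 0
  rw [← ringChange_map]
  change singularCohomology.ringChange (Int.castRingHom ℂ) _ (2 * i)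
    (restrictToCompl ℤ X (2 * i) ((U : Set X.left)ᶜ) (chernClassZ E i)) = 0
  rw [h, map_zero]

/-- **Hence `cᵢ(E)_ℂ ∈ N¹ H²ⁱ(X(ℂ); ℂ)`** (`i ≥ 1`) as soon as `F` has an algebraic frame over one
non-empty Zariski open. [cite: BlochOgus1974ENS, (3.8)] [cite: SerreGAGA1956, §4 n°20] -/
theorem chernClassIn_complex_mem_coniveauFiltration_one_of_comparison (hX : IsSmoothProjective n X)
    (E : ComplexVectorBundle.{0, 0} (ComplexPoints X))
    (α : ∀ U : X.left.Opens, Γ(F, U) → ∀ P : ComplexPoints X, E.E P)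
    (hcont : ∀ (U : X.left.Opens) (σ : Γ(F, U)),
      ContinuousOn (fun P ↦ (⟨P, α U σ P⟩ : TotalSpace E.F E.E)) {P | P.pt ∈ U})
    (hframe : ∀ (U : X.left.Opens) (t : Fin r → Γ(F, U)), IsSectionFrame F U t →
      ∀ P : ComplexPoints X, P.pt ∈ U → LinearIndependent ℂ (fun j ↦ α U (t j) P) ∧
        ⊤ ≤ Submodule.span ℂ (Set.range fun j ↦ α U (t j) P))
    {U : X.left.Opens} (hU : (U : Set X.left).Nonempty) {t : Fin r → Γ(F, U)}
    (ht : IsSectionFrame F U t) {i : ℕ} (hi : 0 < i) :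
    theChernClassTheory.chernClassIn ℂ E i ∈ coniveauFiltration ℂ X (2 * i) 1 := by
  haveI := IsSmoothProjective.isIntegral_holds hX
  obtain ⟨x, hx⟩ := hU
  have hne : ((U : Set X.left)ᶜ) ≠ Set.univ := fun h ↦ (h ▸ Set.mem_univ x : x ∈ (U : Set X.left)ᶜ) hx
  exact (exists_ne_univ_restrictToCompl_eq_zero_iff_mem_coniveauFiltration_one ℂ _).1
    ⟨(U : Set X.left)ᶜ, U.2.isClosed_compl, hne,
      chernClassIn_complex_restrictToOpen_eq_zero_of_comparison hX E α hcont hframe ht hi⟩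

/-- **`c₁(E)_ℂ ∈ algebraicClasses X 1 = N¹ H²(X(ℂ); ℂ)`** for every topological comparison datum of
an `𝒪_X`-module with an algebraic frame over a non-empty Zariski open, on a smooth projective `X`:
the degree-one case (`ch₁ = c₁`) of the field `ch_mem_algebraicClasses` of `ChernCharacterBetti`.
[cite: Fulton1998, Prop. 19.1.2] [cite: BlochOgus1974ENS, (3.8)] -/
theorem chernClassIn_complex_one_mem_algebraicClasses_of_comparison (hX : IsSmoothProjective n X)
    (E : ComplexVectorBundle.{0, 0} (ComplexPoints X))
    (α : ∀ U : X.left.Opens, Γ(F, U) → ∀ P : ComplexPoints X, E.E P)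
    (hcont : ∀ (U : X.left.Opens) (σ : Γ(F, U)),
      ContinuousOn (fun P ↦ (⟨P, α U σ P⟩ : TotalSpace E.F E.E)) {P | P.pt ∈ U})
    (hframe : ∀ (U : X.left.Opens) (t : Fin r → Γ(F, U)), IsSectionFrame F U t →
      ∀ P : ComplexPoints X, P.pt ∈ U → LinearIndependent ℂ (fun j ↦ α U (t j) P) ∧
        ⊤ ≤ Submodule.span ℂ (Set.range fun j ↦ α U (t j) P))
    {U : X.left.Opens} (hU : (U : Set X.left).Nonempty) {t : Fin r → Γ(F, U)}
    (ht : IsSectionFrame F U t) :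
    theChernClassTheory.chernClassIn ℂ E 1 ∈ algebraicClasses X 1 :=
  chernClassIn_complex_mem_coniveauFiltration_one_of_comparison hX E α hcont hframe hU ht one_pos

/-- **K1c packaged with existence**: an `𝒪_X`-module `F` with algebraic frames of size `r` near every
point of a smooth projective `X` has a topological analytification `(E, α)` of rank `r` (step 2) whose
`ℂ`-valued Chern classes `cᵢ(E)_ℂ = theChernClassTheory.chernClassIn ℂ E i ∈ complexBetti X (2 * i)`
are integral classes, die on every trivialising Zariski open and lie in `N¹` for `i ≥ 1`, and whose
`c₁(E)_ℂ` is an algebraic class. [cite: SerreGAGA1956, §3 n°9 Déf. 2 and §4 n°20]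
[cite: HusemollerFibreBundles1994, Ch. 17 Def. 2.6, §3 (C₁), Prop. 4.1 and Ch. 20 §4] [cite: BlochOgus1974ENS, (3.8)] -/
theorem exists_analytification_chernClassIn_complex (hX : IsSmoothProjective n X)
    (hF : ∀ x : X.left, ∃ (U : X.left.Opens) (s : Fin r → Γ(F, U)), x ∈ U ∧ IsSectionFrame F U s) :
    ∃ (E : ComplexVectorBundle.{0, 0} (ComplexPoints X))
      (α : ∀ U : X.left.Opens, Γ(F, U) → ∀ P : ComplexPoints X, E.E P),
      E.rank = r ∧
      (∀ (U : X.left.Opens) (σ τ : Γ(F, U)) (P : ComplexPoints X),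
          α U (σ + τ) P = α U σ P + α U τ P) ∧
      (∀ (U : X.left.Opens) (f : Γ(X.left, U)) (σ : Γ(F, U)) (P : ComplexPoints X) (h : P.pt ∈ U),
          α U (f • σ) P = P.eval U h f • α U σ P) ∧
      (∀ (U W : X.left.Opens) (hWU : W ≤ U) (σ : Γ(F, U)) (P : ComplexPoints X), P.pt ∈ W →
          α W (F.presheaf.map (homOfLE hWU).op σ) P = α U σ P) ∧
      (∀ (U : X.left.Opens) (σ : Γ(F, U)),
          ContinuousOn (fun P ↦ (⟨P, α U σ P⟩ : TotalSpace E.F E.E)) {P | P.pt ∈ U}) ∧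
      (∀ (U : X.left.Opens) (t : Fin r → Γ(F, U)), IsSectionFrame F U t → ∀ P : ComplexPoints X,
          P.pt ∈ U → LinearIndependent ℂ (fun j ↦ α U (t j) P) ∧
            ⊤ ≤ Submodule.span ℂ (Set.range fun j ↦ α U (t j) P)) ∧
      (∀ i : ℕ, IsIntegralClass (theChernClassTheory.chernClassIn ℂ E i : complexBetti X (2 * i))) ∧
      (∀ (U : X.left.Opens) (t : Fin r → Γ(F, U)), IsSectionFrame F U t → ∀ i : ℕ, 0 < i →
          restrictToCompl ℂ X (2 * i) ((U : Set X.left)ᶜ) (theChernClassTheory.chernClassIn ℂ E i) = 0 ∧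
          ((U : Set X.left).Nonempty → theChernClassTheory.chernClassIn ℂ E i ∈ coniveauFiltration ℂ X (2 * i) 1)) ∧
      (∀ (U : X.left.Opens) (t : Fin r → Γ(F, U)), IsSectionFrame F U t → (U : Set X.left).Nonempty →
          theChernClassTheory.chernClassIn ℂ E 1 ∈ algebraicClasses X 1) := by
  obtain ⟨E, α, hrank, hadd, hsmul, hres, hcont, hframe⟩ := exists_topologicalAnalytification hF
  exact ⟨E, α, hrank, hadd, hsmul, hres, hcont, hframe, fun i ↦ isIntegralClass_chernClassIn_complex E i,
    fun U t ht i hi ↦ ⟨chernClassIn_complex_restrictToOpen_eq_zero_of_comparison hX E α hcont hframe ht hi,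
      fun hU ↦ chernClassIn_complex_mem_coniveauFiltration_one_of_comparison hX E α hcont hframe hU ht hi⟩,
    fun U t ht hU ↦ chernClassIn_complex_one_mem_algebraicClasses_of_comparison hX E α hcont hframe hU ht⟩

end Summit.HodgeConjecture.HodgeConjecture.Theorems

end
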